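import Summits.ResolutionOfSingularities.ResolutionOfSingularities.Theorems.HilbertSamuelEliminationSigmaMaxModificationsCorridor3SigmaSurfaceBadness
import Literature.AlgebraicGeometry.Resolution.BlowupRestrictOpen
import HarnessLib

/-!
# [OURS · L1 W4.2] σ-LAYER PHASE B′ — `Corridor3SigmaSurfaceBadnessIso`: THE BADNESS COUNT IS INVARIANT UNDER ISOMORPHISMS OF THE CARRIER —
# `badness (Γs.restrict e) = badness Γs` for an isomorphism `e : D₁ ⟶ D₂` (supports, specialisations, codimensions, orders, multiplicity lists, crossing sets
# and both sums transport), the bookkeeping that reads `M(E′, D′)` on the model `D̃ ≅ D̃′` of the next reduced surface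
# (res-type-067 `exists_iso_menuCentre_surfaceNext` / `Boundary.restrictOff_restrict_of_iso`; this seat's p546417 is the ℓ-twin; crux chain w42 `SigmaMaxModifications`
# stmt-ResolutionOfSingularities-18506 / conjunct `SigmaMaxModificationsCorridor3` stmt-ResolutionOfSingularities-19249; helper of res-L1-w42-stub-1 (gen 6),
# `--supports stmt-…-19249 --as helper`, counted 0)

HONEST FRAMING. OURS bookkeeping over Literature `idealOrder_comap_of_isOpenImmersion` (`…BlowupRestrictOpen`), res-type-067's `Boundary.coe_support_comap`, Mathlib
`coheight_eq_of_isOpenImmersion`, `Topology.IsInducing.specializes_iff`, `finsum_mem_image`, `Set.ncard_preimage_of_injective_subset_range`. NOTHING here is a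
statement of H. Hironaka's manuscript [Hironaka2017] nor of [CossartJannsenSaito2020]; no named fact. AI-written; AI review is weaker than expert review.

## Contents (namespace `…Theorems.SigmaMaxModificationsCorridor3.Sigma`)

* `mem_support_comap_iff`, `membersThrough_restrict` (any morphism; res-type-067's `Boundary.restrict Γs e = Γs.map (·.comap e)`); along an isomorphism `e`:
  `specializes_base_iff_of_isIso`, `divisorialPoints_comap_of_isIso`, `Boundary.compMults_restrict_of_iso`, `Boundary.compBadness_restrict_of_iso`,
  `Boundary.codimOnePoints_restrict_of_iso`, `Boundary.crossingPts_restrict_of_iso`, `Boundary.crossingCount_restrict_of_iso`, `Boundary.finsum_compBadness_restrict_of_iso`,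
  **`Boundary.badness_restrict_of_iso`**.

VACUITY SELF-CHECK. Pure transport along an isomorphism; no hypotheses beyond `IsIso e`.
-/

noncomputable section

set_option linter.dupNamespace false -- mandated namespace of this single-conjunct summit

open CategoryTheory AlgebraicGeometry TopologicalSpace IsLocalRing
open Summit.ResolutionOfSingularities.ResolutionOfSingularities.Theorems.CampaignW42
open Literature.AlgebraicGeometry.Resolution Literature.RingTheory.HilbertSamuel

namespace Summit.ResolutionOfSingularities.ResolutionOfSingularities.Theorems.SigmaMaxModificationsCorridor3.Sigma

universe u

open Scheme.IdealSheafData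

section AnyMorphism

variable {D₁ D₂ : Scheme.{u}} (e : D₁ ⟶ D₂)

/-- Membership in the support of a pulled-back ideal sheaf. [folklore] -/
theorem mem_support_comap_iff (J : D₂.IdealSheafData) (x : D₁) : x ∈ ((J.comap e).support : Set D₁) ↔ e.base x ∈ (J.support : Set D₂) := by
  rw [Boundary.coe_support_comap]; rfl

open scoped Classical in
/-- **The members through `x` of a pulled-back list are the pull-backs of the members through `e x`.** [folklore] -/
theorem membersThrough_restrict (Γs : Boundary D₂) (x : D₁) :
    membersThrough (Γs.restrict e) x = (membersThrough Γs (e.base x)).map fun J => J.comap e := by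
  unfold membersThrough Boundary.restrict
  rw [List.filter_map]
  congr 1
  refine List.filter_congr fun J _ => ?_
  simp only [Function.comp_apply, decide_eq_decide]
  exact mem_support_comap_iff e J x

end AnyMorphism

section Iso

variable {D₁ D₂ : Scheme.{u}} (e : D₁ ⟶ D₂) [IsIso e]

/-- Specialisation is read through an isomorphism. [folklore] -/
theorem specializes_base_iff_of_isIso (x y : D₁) : e.base x ⤳ e.base y ↔ x ⤳ y :=
  e.isOpenEmbedding.isInducing.specializes_iff

/-- **Divisorial points transport**: `divisorialPoints (e^*J) = e⁻¹ (divisorialPoints J)`. [folklore] -/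
theorem divisorialPoints_comap_of_isIso (J : D₂.IdealSheafData) : divisorialPoints (J.comap e) = e.base ⁻¹' divisorialPoints J := by
  ext x
  rw [mem_divisorialPoints_iff, Set.mem_preimage, mem_divisorialPoints_iff, ← SetLike.mem_coe, mem_support_comap_iff, coheight_eq_of_isOpenImmersion e]
  rfl

/-- **Multiplicity lists transport.** [folklore] -/
theorem Boundary.compMults_restrict_of_iso (Γs : Boundary D₂) (x : D₁) : (Γs.restrict e).compMults x = Γs.compMults (e.base x) := by
  unfold Boundary.compMults
  rw [membersThrough_restrict, List.map_map]
  refine List.map_congr_left fun J _ => ?_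
  simp only [Function.comp_apply]
  rw [idealOrder_comap_of_isOpenImmersion e J x]

/-- Component badness transports. [folklore] -/
theorem Boundary.compBadness_restrict_of_iso (Γs : Boundary D₂) (x : D₁) : (Γs.restrict e).compBadness x = Γs.compBadness (e.base x) := by
  rw [Boundary.compBadness_eq, Boundary.compBadness_eq, Boundary.compMults_restrict_of_iso]

/-- Codimension-one points transport. [folklore] -/
theorem Boundary.codimOnePoints_restrict_of_iso (Γs : Boundary D₂) : (Γs.restrict e).codimOnePoints = e.base ⁻¹' Γs.codimOnePoints := by
  ext x
  rw [Boundary.mem_codimOnePoints_iff, Boundary.divisorSet_restrict, Set.mem_preimage, Set.mem_preimage, Boundary.mem_codimOnePoints_iff,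
    coheight_eq_of_isOpenImmersion e]

/-- **Crossing sets transport**: `crossingPts (Γs.map e^*) (e^*J) = e⁻¹ (crossingPts Γs J)`. [folklore] -/
theorem Boundary.crossingPts_restrict_of_iso (Γs : Boundary D₂) (J : D₂.IdealSheafData) :
    (Γs.restrict e).crossingPts (J.comap e) = e.base ⁻¹' Γs.crossingPts J := by
  ext x
  rw [Set.mem_preimage, Boundary.mem_crossingPts_iff, Boundary.mem_crossingPts_iff, divisorialPoints_comap_of_isIso, Boundary.codimOnePoints_restrict_of_iso]
  refine and_congr ?_ ?_
  · constructor
    · rintro ⟨ζ₁, h₁, ζ₂, h₂, hne, hs₁, hs₂⟩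
      exact ⟨e.base ζ₁, h₁, e.base ζ₂, h₂, fun h => hne (e.isOpenEmbedding.injective h), (specializes_base_iff_of_isIso e _ _).mpr hs₁,
        (specializes_base_iff_of_isIso e _ _).mpr hs₂⟩
    · rintro ⟨ζ₁', h₁, ζ₂', h₂, hne, hs₁, hs₂⟩
      obtain ⟨ζ₁, rfl⟩ := e.surjective ζ₁'
      obtain ⟨ζ₂, rfl⟩ := e.surjective ζ₂'
      exact ⟨ζ₁, h₁, ζ₂, h₂, fun h => hne (h ▸ rfl), (specializes_base_iff_of_isIso e _ _).mp hs₁, (specializes_base_iff_of_isIso e _ _).mp hs₂⟩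
  · constructor
    · intro h η' hη' hs'
      obtain ⟨η, rfl⟩ := e.surjective η'
      have := h η hη' ((specializes_base_iff_of_isIso e _ _).mp hs')
      rwa [Boundary.compMults_restrict_of_iso] at this
    · intro h η hη hs
      have := h (e.base η) hη ((specializes_base_iff_of_isIso e _ _).mpr hs)
      rwa [Boundary.compMults_restrict_of_iso]

/-- **The crossing count transports.** [folklore] -/
theorem Boundary.crossingCount_restrict_of_iso (Γs : Boundary D₂) : (Γs.restrict e).crossingCount = Γs.crossingCount := by
  unfold Boundary.crossingCount
  change ((Γs.map fun J => J.comap e).map fun Γ => ((Γs.restrict e).crossingPts Γ).ncard).sum = _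
  rw [List.map_map]
  refine congrArg List.sum (List.map_congr_left fun J _ => ?_)
  simp only [Function.comp_apply]
  rw [Boundary.crossingPts_restrict_of_iso]
  exact Set.ncard_preimage_of_injective_subset_range e.isOpenEmbedding.injective fun y _ => e.surjective y

/-- **The component sum transports.** [folklore] -/
theorem Boundary.finsum_compBadness_restrict_of_iso (Γs : Boundary D₂) :
    ∑ᶠ ζ ∈ (Γs.restrict e).codimOnePoints, (Γs.restrict e).compBadness ζ = ∑ᶠ ζ ∈ Γs.codimOnePoints, Γs.compBadness ζ := by
  rw [Boundary.codimOnePoints_restrict_of_iso]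
  simp_rw [Boundary.compBadness_restrict_of_iso]
  have himg : e.base '' (e.base ⁻¹' Γs.codimOnePoints) = Γs.codimOnePoints := Set.image_preimage_eq _ e.surjective
  conv_rhs => rw [← himg]
  rw [finsum_mem_image (e.isOpenEmbedding.injective.injOn)]

/-- **THE BADNESS COUNT IS INVARIANT UNDER ISOMORPHISMS OF THE CARRIER.** [folklore] -/
theorem Boundary.badness_restrict_of_iso (Γs : Boundary D₂) : (Γs.restrict e).badness = Γs.badness := by
  unfold Boundary.badness
  rw [Boundary.finsum_compBadness_restrict_of_iso, Boundary.crossingCount_restrict_of_iso]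

end Iso

end Summit.ResolutionOfSingularities.ResolutionOfSingularities.Theorems.SigmaMaxModificationsCorridor3.Sigma

end
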